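import Literature.AlgebraicTopology.FundamentalGroup.PuncturedTorusSquareWord
import Literature.AlgebraicTopology.FundamentalGroup.DeformationRetractInclusion
import Mathlib.Analysis.Normed.Group.AddCircle
import HarnessLib

/-!
# The punctured torus deformation retracts onto the wedge of its edge circles

Topic `Literature/AlgebraicTopology/FundamentalGroup`; sequel of `PuncturedTorusSquareWord.lean`
(the real torus `T = (ℝ/ℤ)^ι` as the square with edges identified, A. Hatcher, *Algebraic
Topology* (2002), §1.2 p. 51) and companion of `PuncturedTorusCommutator.lean`.  For a point
`x₀ ∈ T = ι → AddCircle 1` (`ι` finite) write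

  `W(x₀) = {p ∈ T | ∃ i, p i - x₀ i = 1/2 (mod 1)}`

— for two indices this is the WEDGE OF THE TWO EDGE CIRCLES `{p | p i₀ = x₀ i₀ + ½} ∪
{p | p i₁ = x₀ i₁ + ½}` of the square of side `1` centred at `x₀` (the image of the boundary of
the square under the identifications; Hatcher, Example 1.22 / §1.2 p. 51: "the torus with a point
deleted deformation retracts onto the figure eight `S¹ ∨ S¹`").  We PROVE:

* `isStrongDeformationRetractOf_wedge_compl_singleton` — **`W(x₀)` is a strong deformation retract
  of the punctured torus `T ∖ {x₀}`**: the radial deformation of the punctured square (push `p`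
  away from `x₀` along the ray from `x₀` until the sup-norm distance `‖p - x₀‖` reaches `½`),
  written intrinsically on `T` as `H_t(p) = p + t·((2‖p - x₀‖)⁻¹ - 1)·u(p)` with `u(p) ∈ (-½, ½]^ι`
  the lift of `p - x₀`; the lift is discontinuous exactly along `W(x₀)`, where the scalar factor
  vanishes, so `H` is continuous (Hatcher, proof of Prop. 1.26, radial deformation retraction);
* `bijective_inclHom_wedge_compl_singleton` — hence the inclusion induces an ISOMORPHISM
  `π₁(W(x₀), w) ≅ π₁(T ∖ {x₀}, w)` at every `w ∈ W(x₀)` (Hatcher, Prop. 1.17, the tree's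
  `bijective_inclHomOfSubset_of_isStrongDeformationRetractOf`);
* `mem_wedge_iff_norm_eq`, `wedge_subset_compl_singleton`, `projC_zero_eq`, `mem_wedge_projC_iff`
  — bookkeeping: `p ∈ W(x₀) ↔ ‖p - x₀‖ = ½`; the centre of the tree's scaled chart `projC c` is
  `x₀ = (c i mod 1)ᵢ` and `W` is `{p | ∃ i, p i = c i + ½ (mod 1)}`.

Written for the computation `π₁(T ∖ {x₀}) ≅ F₂` of the once-punctured torus (abc-iut cell,
campaign-L R1 step (3ε): the type-`(1,1)` instance — once-punctured elliptic curves — of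
«`Cov^fin` of a hyperbolic Riemann surface is id-rigid»).  Proof-only: no definitions.

## References
* A. Hatcher, *Algebraic Topology*, CUP (2002), §1.2 p. 51 and Example 1.22; Prop. 1.17;
  proof of Prop. 1.26. [HatcherAT2002]
-/

noncomputable section

open Set Function Metric Filter
open scoped Topology unitInterval

namespace Literature.AlgebraicTopology.FundamentalGroup

namespace PuncturedTorus

variable {ι : Type*} [Fintype ι]

/-! ### §1 The lift of `p - x₀` to the half-open square `(-½, ½]^ι` -/

/-- The chosen lift `u ∈ (-½, ½]` of a point of `ℝ/ℤ` projects back to it. [cite: HatcherAT2002, §1.2 p. 51] -/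
theorem coe_equivIoc_half (y : AddCircle (1 : ℝ)) :
    (((AddCircle.equivIoc (1 : ℝ) (-2⁻¹) y : ℝ)) : AddCircle (1 : ℝ)) = y :=
  AddCircle.coe_equivIoc

/-- The chosen lift `u ∈ (-½, ½]` of a point `y` of `ℝ/ℤ` has `|u| = ‖y‖`.
[cite: HatcherAT2002, §1.2 p. 51] -/
theorem abs_equivIoc_half (y : AddCircle (1 : ℝ)) :
    |((AddCircle.equivIoc (1 : ℝ) (-2⁻¹) y : ℝ))| = ‖y‖ := by
  set u : ℝ := (AddCircle.equivIoc (1 : ℝ) (-2⁻¹) y : ℝ) with hu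
  have hmem : u ∈ Ioc (-2⁻¹ : ℝ) (-2⁻¹ + 1) := (AddCircle.equivIoc (1 : ℝ) (-2⁻¹) y).2
  have habs : |u| ≤ |(1 : ℝ)| / 2 := by
    rw [abs_one, abs_le]; constructor <;> linarith [hmem.1, hmem.2]
  rw [← (AddCircle.norm_coe_eq_abs_iff (p := (1 : ℝ)) one_ne_zero).2 habs, hu,
    coe_equivIoc_half]

/-- Every point of `ℝ/ℤ` has norm at most `½`. [cite: HatcherAT2002, §1.2 p. 51] -/
theorem norm_le_half (y : AddCircle (1 : ℝ)) : ‖y‖ ≤ 2⁻¹ := by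
  have h := AddCircle.norm_le_half_period (1 : ℝ) (x := y) one_ne_zero
  rw [abs_one] at h
  linarith

/-- In `ℝ/ℤ`, `‖y‖ = ½` iff `y = ½ (mod 1)`. [cite: HatcherAT2002, §1.2 p. 51] -/
theorem norm_eq_half_iff (y : AddCircle (1 : ℝ)) :
    ‖y‖ = 2⁻¹ ↔ y = ((2⁻¹ : ℝ) : AddCircle (1 : ℝ)) := by
  constructor
  · intro h
    set u : ℝ := (AddCircle.equivIoc (1 : ℝ) (-2⁻¹) y : ℝ) with hu
    have hmem : u ∈ Ioc (-2⁻¹ : ℝ) (-2⁻¹ + 1) := (AddCircle.equivIoc (1 : ℝ) (-2⁻¹) y).2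
    have habs : |u| = 2⁻¹ := by rw [hu, abs_equivIoc_half, h]
    have hu' : u = 2⁻¹ := by
      rcases (abs_eq (by norm_num : (0 : ℝ) ≤ 2⁻¹)).1 habs with h' | h'
      · exact h'
      · exfalso; linarith [hmem.1]
    rw [← coe_equivIoc_half y, ← hu, hu']
  · rintro rfl
    have := AddCircle.norm_half_period_eq (p := (1 : ℝ))
    rw [abs_one, one_div] at this
    exact this

/-! ### §2 The sup norm `‖p - x₀‖` on the torus and the wedge `W(x₀)` -/

/-- `‖p - x₀‖ ≤ ½` on the torus (sup norm of coordinates of norm `≤ ½`). [cite: HatcherAT2002, §1.2 p. 51] -/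
theorem norm_sub_le_half (p x₀ : ι → AddCircle (1 : ℝ)) : ‖p - x₀‖ ≤ 2⁻¹ :=
  (pi_norm_le_iff_of_nonneg (by norm_num)).2 fun i ↦ norm_le_half _

/-- **Membership in the wedge `W(x₀)` is `‖p - x₀‖ = ½`.** [cite: HatcherAT2002, §1.2 p. 51] -/
theorem mem_wedge_iff_norm_eq (x₀ p : ι → AddCircle (1 : ℝ)) :
    p ∈ {p : ι → AddCircle (1 : ℝ) | ∃ i, p i - x₀ i = ((2⁻¹ : ℝ) : AddCircle (1 : ℝ))} ↔
      ‖p - x₀‖ = 2⁻¹ := by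
  constructor
  · rintro ⟨i, hi⟩
    refine le_antisymm (norm_sub_le_half p x₀) ?_
    have h1 : ‖(p - x₀) i‖ = 2⁻¹ := by rw [Pi.sub_apply, hi]; exact (norm_eq_half_iff _).2 rfl
    rw [← h1]
    exact norm_le_pi_norm (p - x₀) i
  · intro h
    -- the sup norm is attained at some coordinate
    classical
    have hne : (Finset.univ : Finset ι).Nonempty := by
      by_contra hι
      rw [Finset.not_nonempty_iff_eq_empty, Finset.univ_eq_empty_iff] at hι
      have : ‖p - x₀‖ = 0 := by
        haveI := hι
        exact norm_eq_zero.mpr (Subsingleton.elim _ _)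
      rw [this] at h; norm_num at h
    obtain ⟨i, -, hi⟩ := Finset.exists_mem_eq_sup Finset.univ hne fun b ↦ ‖(p - x₀) b‖₊
    have hdef : ‖p - x₀‖ = ((Finset.univ.sup fun b ↦ ‖(p - x₀) b‖₊ : NNReal) : ℝ) := Pi.norm_def _
    rw [hdef, hi, coe_nnnorm, Pi.sub_apply] at h
    exact ⟨i, (norm_eq_half_iff _).1 h⟩

/-- The wedge misses the puncture: `W(x₀) ⊆ T ∖ {x₀}`. [cite: HatcherAT2002, §1.2 p. 51] -/
theorem wedge_subset_compl_singleton (x₀ : ι → AddCircle (1 : ℝ)) :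
    {p : ι → AddCircle (1 : ℝ) | ∃ i, p i - x₀ i = ((2⁻¹ : ℝ) : AddCircle (1 : ℝ))} ⊆ {x₀}ᶜ := by
  intro p hp h
  rw [mem_singleton_iff] at h
  rw [mem_wedge_iff_norm_eq, h, sub_self, norm_zero] at hp
  norm_num at hp

/-! ### §3 The radial deformation retraction of `T ∖ {x₀}` onto `W(x₀)` -/

/-- **The punctured torus deformation retracts onto the wedge of its edge circles** (Hatcher,
Example 1.22 / §1.2 p. 51, by the radial deformation retraction of the proof of Prop. 1.26 pushed
through the identifications of the square): `W(x₀) = {p | ∃ i, p i - x₀ i = ½}` is a strong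
deformation retract of `T ∖ {x₀}`, `T = (ℝ/ℤ)^ι`, `ι` finite.  The homotopy is
`H_t(p) = p + t·((2‖p - x₀‖)⁻¹ - 1)·u(p)` with `u(p) ∈ (-½, ½]^ι` the lift of `p - x₀`.
[cite: HatcherAT2002, §1.2 Example 1.22 (p. 51); proof of Prop. 1.26] -/
theorem isStrongDeformationRetractOf_wedge_compl_singleton (x₀ : ι → AddCircle (1 : ℝ)) :
    Homotopy.IsStrongDeformationRetractOf
      {p : ι → AddCircle (1 : ℝ) | ∃ i, p i - x₀ i = ((2⁻¹ : ℝ) : AddCircle (1 : ℝ))} {x₀}ᶜ := by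
  classical
  -- the lift `u i p ∈ (-½, ½]` of `p i - x₀ i`, the radius `r p = ‖p - x₀‖`, the scalar `g t p`
  set u : ι → (ι → AddCircle (1 : ℝ)) → ℝ :=
    fun i p ↦ (AddCircle.equivIoc (1 : ℝ) (-2⁻¹) (p i - x₀ i) : ℝ) with hu_def
  set g : ℝ → (ι → AddCircle (1 : ℝ)) → ℝ := fun t p ↦ t * ((2 * ‖p - x₀‖)⁻¹ - 1) with hg_def
  set H : ℝ → (ι → AddCircle (1 : ℝ)) → (ι → AddCircle (1 : ℝ)) :=
    fun t p ↦ p + fun i ↦ (((g t p * u i p : ℝ)) : AddCircle (1 : ℝ)) with hH_def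
  have hu_coe : ∀ i p, ((u i p : ℝ) : AddCircle (1 : ℝ)) = p i - x₀ i := fun i p ↦ coe_equivIoc_half _
  have hu_abs : ∀ i p, |u i p| = ‖(p - x₀) i‖ := fun i p ↦ abs_equivIoc_half _
  have hu_le : ∀ i p, |u i p| ≤ ‖p - x₀‖ := fun i p ↦ (hu_abs i p).symm ▸ norm_le_pi_norm _ i
  -- coordinates of `H t p - x₀` : the real numbers `(1 + g t p) * u i p`
  have hH_sub : ∀ t p i, H t p i - x₀ i = (((1 + g t p) * u i p : ℝ) : AddCircle (1 : ℝ)) := by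
    intro t p i
    simp only [hH_def, Pi.add_apply]
    rw [add_mul, one_mul, AddCircle.coe_add, hu_coe]
    abel
  refine Homotopy.IsStrongDeformationRetractOf.of_continuousOn H ?_ ?_ ?_ ?_ ?_
  · -- continuity on `[0, 1] × (T ∖ {x₀})` (in fact on `ℝ × (T ∖ {x₀})`)
    have hS : ∀ q : ℝ × (ι → AddCircle (1 : ℝ)), q ∈ Icc (0 : ℝ) 1 ×ˢ ({x₀}ᶜ : Set _) →
        q.2 - x₀ ≠ 0 := fun q hq ↦ sub_ne_zero.2 hq.2
    have hg : ContinuousOn (fun q : ℝ × (ι → AddCircle (1 : ℝ)) ↦ g q.1 q.2)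
        (Icc (0 : ℝ) 1 ×ˢ ({x₀}ᶜ : Set _)) := by
      refine continuous_fst.continuousOn.mul ((ContinuousOn.inv₀ ?_ ?_).sub continuousOn_const)
      · exact (continuousOn_const.mul ((continuous_snd.sub continuous_const).norm.continuousOn))
      · intro q hq
        exact mul_ne_zero two_ne_zero (norm_ne_zero_iff.2 (hS q hq))
    have hcoord : ∀ i, ContinuousOn (fun q : ℝ × (ι → AddCircle (1 : ℝ)) ↦ g q.1 q.2 * u i q.2)
        (Icc (0 : ℝ) 1 ×ˢ ({x₀}ᶜ : Set _)) := by
      intro i q hq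
      by_cases hcut : q.2 i - x₀ i = ((2⁻¹ : ℝ) : AddCircle (1 : ℝ))
      · -- on the cut locus the scalar vanishes and the lift is bounded: squeeze
        have hr : ‖q.2 - x₀‖ = 2⁻¹ := (mem_wedge_iff_norm_eq x₀ q.2).1 ⟨i, hcut⟩
        have hg0 : g q.1 q.2 = 0 := by simp only [hg_def, hr]; norm_num
        have hval : g q.1 q.2 * u i q.2 = 0 := by rw [hg0, zero_mul]
        rw [ContinuousWithinAt, hval]
        have hg' : Tendsto (fun q' : ℝ × (ι → AddCircle (1 : ℝ)) ↦ g q'.1 q'.2)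
            (𝓝[Icc (0 : ℝ) 1 ×ˢ ({x₀}ᶜ : Set _)] q) (𝓝 0) := hg0 ▸ hg q hq
        refine squeeze_zero_norm' (Eventually.of_forall fun q' ↦ ?_)
          (by simpa using hg'.norm.mul_const (2⁻¹ : ℝ))
        rw [norm_mul, Real.norm_eq_abs (u i q'.2)]
        exact mul_le_mul_of_nonneg_left ((hu_le i q'.2).trans (norm_sub_le_half _ _))
          (norm_nonneg _)
      · -- off the cut locus the lift is continuous
        have hcont : ContinuousAt (fun p : ι → AddCircle (1 : ℝ) ↦ u i p) q.2 := by
          have h1 : ContinuousAt (fun p : ι → AddCircle (1 : ℝ) ↦ p i - x₀ i) q.2 :=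
            ((continuous_apply i).sub continuous_const).continuousAt
          have h2 : ContinuousAt (AddCircle.equivIoc (1 : ℝ) (-2⁻¹)) (q.2 i - x₀ i) := by
            refine AddCircle.continuousAt_equivIoc (p := (1 : ℝ)) (a := (-2⁻¹ : ℝ)) ?_
            intro h
            apply hcut
            rw [h, ← AddCircle.coe_add_period (1 : ℝ) (-2⁻¹ : ℝ)]
            norm_num
          have h3 : ContinuousAt
              (fun p : ι → AddCircle (1 : ℝ) ↦ AddCircle.equivIoc (1 : ℝ) (-2⁻¹) (p i - x₀ i)) q.2 :=
            ContinuousAt.comp (g := AddCircle.equivIoc (1 : ℝ) (-2⁻¹))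
              (f := fun p : ι → AddCircle (1 : ℝ) ↦ p i - x₀ i) h2 h1
          exact continuous_subtype_val.continuousAt.comp h3
        exact (hg q hq).mul (hcont.comp_continuousWithinAt continuous_snd.continuousWithinAt)
    have hD : ContinuousOn (fun q : ℝ × (ι → AddCircle (1 : ℝ)) ↦
        fun i ↦ (((g q.1 q.2 * u i q.2 : ℝ)) : AddCircle (1 : ℝ))) (Icc (0 : ℝ) 1 ×ˢ ({x₀}ᶜ : Set _)) :=
      continuousOn_pi.2 fun i ↦ (AddCircle.continuous_mk' (1 : ℝ)).comp_continuousOn (hcoord i)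
    exact continuous_snd.continuousOn.add hD
  · -- `H t` maps `T ∖ {x₀}` into itself
    intro t ht p hp hx
    rw [mem_singleton_iff] at hx
    apply hp
    rw [mem_singleton_iff, ← sub_eq_zero, ← norm_eq_zero]
    -- every coordinate `(1 + g) u i` is an integer of absolute value `≤ ½`, hence `0`
    have hlam : 0 < 1 + g t p := by
      have hr : 0 < ‖p - x₀‖ := norm_pos_iff.2 (sub_ne_zero.2 hp)
      have hr' : 1 ≤ (2 * ‖p - x₀‖)⁻¹ := by
        rw [one_le_inv₀ (by positivity)]; linarith [norm_sub_le_half p x₀]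
      simp only [hg_def]; nlinarith [ht.1, ht.2]
    have hzero : ∀ i, u i p = 0 := by
      intro i
      have hi : (((1 + g t p) * u i p : ℝ) : AddCircle (1 : ℝ)) = 0 := by
        rw [← hH_sub, hx, sub_self]
      obtain ⟨n, hn⟩ := (AddCircle.coe_eq_zero_iff (1 : ℝ)).1 hi
      rw [zsmul_eq_mul, mul_one] at hn
      -- `|n| ≤ (1 + g) ‖p - x₀‖ ≤ ½`
      have hbound : |((1 + g t p) * u i p : ℝ)| ≤ 2⁻¹ := by
        rw [abs_mul, abs_of_pos hlam]
        calc (1 + g t p) * |u i p| ≤ (1 + g t p) * ‖p - x₀‖ :=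
              mul_le_mul_of_nonneg_left (hu_le i p) hlam.le
          _ = (1 - t) * ‖p - x₀‖ + t * 2⁻¹ := by
              have hr : ‖p - x₀‖ ≠ 0 := norm_ne_zero_iff.2 (sub_ne_zero.2 hp)
              simp only [hg_def]; field_simp; ring
          _ ≤ (1 - t) * 2⁻¹ + t * 2⁻¹ := by
              nlinarith [norm_sub_le_half p x₀, ht.1, ht.2, norm_nonneg (p - x₀)]
          _ = 2⁻¹ := by ring
      rw [← hn] at hbound
      have hn0 : n = 0 := by
        have h' : |(n : ℝ)| < 1 := by linarith
        rw [← Int.cast_abs] at h'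
        exact Int.abs_lt_one_iff.1 (by exact_mod_cast h')
      rw [hn0, Int.cast_zero] at hn
      rcases mul_eq_zero.1 hn.symm with h' | h'
      · exact absurd h' hlam.ne'
      · exact h'
    refine le_antisymm ((pi_norm_le_iff_of_nonneg le_rfl).2 fun i ↦ ?_) (norm_nonneg _)
    rw [← hu_abs, hzero, abs_zero]
  · -- `H 0 = id`
    intro p _
    simp only [hH_def, hg_def, zero_mul, AddCircle.coe_zero]
    exact add_eq_left.2 rfl
  · -- `H 1` lands in the wedge: the largest coordinate of `u / (2‖p - x₀‖)` is `± ½`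
    intro p hp
    have hr : 0 < ‖p - x₀‖ := norm_pos_iff.2 (sub_ne_zero.2 hp)
    have hne : (Finset.univ : Finset ι).Nonempty := by
      by_contra hι
      rw [Finset.not_nonempty_iff_eq_empty, Finset.univ_eq_empty_iff] at hι
      haveI := hι
      exact hp (Subsingleton.elim _ _)
    obtain ⟨i, -, hi⟩ := Finset.exists_mem_eq_sup Finset.univ hne fun b ↦ ‖(p - x₀) b‖₊
    have hdef : ‖p - x₀‖ = ((Finset.univ.sup fun b ↦ ‖(p - x₀) b‖₊ : NNReal) : ℝ) := Pi.norm_def _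
    have hmax : |u i p| = ‖p - x₀‖ := by rw [hu_abs, hdef, hi, coe_nnnorm]
    refine ⟨i, ?_⟩
    rw [hH_sub]
    have hg1 : 1 + g 1 p = (2 * ‖p - x₀‖)⁻¹ := by simp only [hg_def]; ring
    rw [hg1]
    rcases (abs_eq hr.le).1 hmax with h' | h'
    · rw [h']; congr 1; field_simp
    · rw [h', show ((2 * ‖p - x₀‖)⁻¹ * -‖p - x₀‖ : ℝ) = 2⁻¹ - 1 by field_simp; ring,
        AddCircle.coe_sub, AddCircle.coe_period, sub_zero]
  · -- points of the wedge stay fixed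
    intro t _ p _ hpW
    have hr : ‖p - x₀‖ = 2⁻¹ := (mem_wedge_iff_norm_eq x₀ p).1 hpW
    have hg0 : g t p = 0 := by simp only [hg_def, hr]; norm_num
    simp only [hH_def, hg0, zero_mul, AddCircle.coe_zero]
    exact add_eq_left.2 rfl

/-! ### §4 Consequence for fundamental groups -/

/-- **`π₁(W(x₀), w) ≅ π₁(T ∖ {x₀}, w)`**: for every base point `w` of the wedge, the homomorphism
induced by the inclusion `W(x₀) ↪ T ∖ {x₀}` is bijective (Hatcher, Prop. 1.17 applied to the
deformation retraction of Example 1.22). [cite: HatcherAT2002, Prop. 1.17; §1.2 Example 1.22] -/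
theorem bijective_inclHom_wedge_compl_singleton (x₀ : ι → AddCircle (1 : ℝ))
    {w : ι → AddCircle (1 : ℝ)}
    (hw : w ∈ {p : ι → AddCircle (1 : ℝ) | ∃ i, p i - x₀ i = ((2⁻¹ : ℝ) : AddCircle (1 : ℝ))}) :
    Function.Bijective (VanKampen.inclHomOfSubset (wedge_subset_compl_singleton x₀) w hw
      (wedge_subset_compl_singleton x₀ hw)) :=
  VanKampen.bijective_inclHomOfSubset_of_isStrongDeformationRetractOf
    (isStrongDeformationRetractOf_wedge_compl_singleton x₀) _ hw

/-! ### §5 Bookkeeping with the scaled chart `projC` of `PuncturedTorusSquareWord` -/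

omit [Fintype ι] in
/-- The centre of the chart `projC c` is `x₀ = (c i mod 1)ᵢ`. [cite: HatcherAT2002, §1.2 p. 51] -/
theorem projC_zero_eq (c : ι → ℝ) : projC c 0 = fun i ↦ ((c i : ℝ) : AddCircle (1 : ℝ)) := by
  funext i; simp

omit [Fintype ι] in
/-- Membership in the wedge `W(projC c 0)` in the chart's terms: `p i = c i + ½ (mod 1)` for some
`i`. [cite: HatcherAT2002, §1.2 p. 51] -/
theorem mem_wedge_projC_iff (c : ι → ℝ) (p : ι → AddCircle (1 : ℝ)) :
    p ∈ {p : ι → AddCircle (1 : ℝ) | ∃ i, p i - projC c 0 i = ((2⁻¹ : ℝ) : AddCircle (1 : ℝ))} ↔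
      ∃ i, p i = ((c i + 2⁻¹ : ℝ) : AddCircle (1 : ℝ)) := by
  simp only [mem_setOf_eq, projC_apply, Pi.zero_apply, mul_zero, add_zero, sub_eq_iff_eq_add,
    ← AddCircle.coe_add, add_comm (2⁻¹ : ℝ)]

end PuncturedTorus

end Literature.AlgebraicTopology.FundamentalGroup

end
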